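import Summits.AtomisticToContinuum.HydrodynamicLimit.Theses.WarmColdDichotomy
import Summits.AtomisticToContinuum.HydrodynamicLimit.Theses.OneFlightGossipEngine
import Summits.AtomisticToContinuum.HydrodynamicLimit.Theorems.OneFlightGossipEngineEnergyCurrentTailsLevelCensusLedger
import Summits.AtomisticToContinuum.HydrodynamicLimit.Theorems.OneFlightGossipEngineEnergyCurrentTailsLevelCensusClosure
import Summits.AtomisticToContinuum.HydrodynamicLimit.Theorems.OneFlightGossipEngineEnergyCurrentTailsLevelCensusTransfer
import HarnessLib

/-!
# Line `level-census-comparison` (crux `EnergyCurrentTails`, stmt-AtomisticToContinuum-9235): THE CERTIFIED REDUCTION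

Support file (`--supports stmt-AtomisticToContinuum-9235`) of the line lead (seat c2,
`prover-line-stmt-AtomisticToContinuum-9235-c2-0`).  With the census ledger A (`stub_censusLedger`, p111677), the
census closure C (`stub_censusClosure`, worker file `…LevelCensusClosure`), the transfer T (`stub_censusTransfer`) and the
Chebyshev docking (`quarticDocking`, both `…LevelCensusTransfer`, p109372) LANDED, the registered skeleton
`Cruxes/EnergyCurrentTails/Lines/level_census_comparison.lean` collapses to ONE implication in the tree, recorded here
(registered helper `energyCurrentTails_of_contactChaos`):

  `RateCeiling → MergeCeiling → SplitFloor → …Theses.WarmColdDichotomy.EnergyCurrentTails`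

(and the same for the byte-identical `OneFlightGossipEngine` copy).  The three antecedents are the line's OPEN dynamical stubs
F1 `stub_rateCeiling`, F2 `stub_mergeCeiling`, F3 `stub_splitFloor` (Props of `…LevelCensusObjects`): one-sided, constant-factor
EXPECTED COLLISION-COUNT inequalities under the EVOLVED law — the upper half (F1, F2: instances of the open crux
`ContactIntensityDomination`, stmt-AtomisticToContinuum-9218, up to an enlargement of the shells/classes) and the lower half
(F3: energetic splitting floor; no item yet) of CONSTANT-FACTOR INCOMING MOLECULAR CHAOS AT CONTACT FOR ENERGETIC PARTICLES.
All three hold at global equilibrium with their typed shapes (`stub_rateCeilingRung0` p111324, `stub_mergeCeilingRung0`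
p111615, `stub_splitFloorRung0` p112692).  This theorem is CONDITIONAL (it credits nothing toward the item); it is the dock
through which any future producer of F1 ∧ F2 ∧ F3 closes the crux verbatim.
-/

noncomputable section

namespace Summit.AtomisticToContinuum.HydrodynamicLimit.Theorems.EnergyCurrentTailsLevelCensus

/-- **The certified reduction of the crux `EnergyCurrentTails` along the line `level-census-comparison`**: the three
open dynamical stubs F1 (`RateCeiling`), F2 (`MergeCeiling`), F3 (`SplitFloor`) imply the crux
`WarmColdDichotomy.EnergyCurrentTails` BY NAME — census ledger (A, landed) + census closure (C, landed: the continuous-time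
comparison principle instantiated with the barrier `β(N+1)e^{−αE}E^{−2}`) give the Gaussian census bound, the layer-cake
transfer (T, landed) the uniform quartic moment, and Chebyshev (landed) the cubic uniform integrability. -/
theorem energyCurrentTails_of_contactChaos :
    RateCeiling → MergeCeiling → SplitFloor →
      Summit.AtomisticToContinuum.HydrodynamicLimit.Theses.WarmColdDichotomy.EnergyCurrentTails :=
  fun h₁ h₂ h₃ => energyCurrentTails_of_gaussianCensusBound (stub_censusClosure stub_censusLedger h₁ h₂ h₃)

/-- The same reduction for the `OneFlightGossipEngine` copy of the crux (payload route of the line). -/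
theorem energyCurrentTails_oneFlight_of_contactChaos :
    RateCeiling → MergeCeiling → SplitFloor →
      Summit.AtomisticToContinuum.HydrodynamicLimit.Theses.OneFlightGossipEngine.EnergyCurrentTails :=
  fun h₁ h₂ h₃ => energyCurrentTails_oneFlight_of_gaussianCensusBound (stub_censusClosure stub_censusLedger h₁ h₂ h₃)

end Summit.AtomisticToContinuum.HydrodynamicLimit.Theorems.EnergyCurrentTailsLevelCensus

end
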